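import Literature.MathematicalPhysics.QuantumLattice.LocalPairOn
import Literature.MathematicalPhysics.QuantumLattice.HubbardWave0LiebProofs
import HarnessLib

/-!
# The pair-chirality density `O_χ(x) = i (P₁(x)† P₂(x) - P₂(x)† P₁(x))` of a `d_{x²-y²} ± i d_xy` condensate

Topic `Literature/MathematicalPhysics/QuantumLattice` (extension of `PairCorrelations` and
`LocalPairOn`). On the fermionic torus `(ℤ/Lℤ)²` with Hubbard orbitals `Orb (FermionTorus 2 L)` let

* `P₁(x) = localPair dWaveFormFactor L x` — the nearest-neighbour singlet pair with the `B₁g`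
  (`d_{x²-y²}`) form factor (`PairCorrelations`);
* `P₂(x) = localPairOn diagSteps dxyFormFactor L x = (1/√2) (B_x(1,1) + B_x(-1,-1) - B_x(1,-1) - B_x(-1,1))`
  — the next-nearest-neighbour (diagonal) singlet pair with the `B₂g` (`d_xy`) form factor
  (`LocalPairOn`; `B_x(e) = singletBond L x e = c_{x↑} c_{x+e,↓} - c_{x↓} c_{x+e,↑}`).

The **pair-chirality density** is the Hermitian, charge-neutral, spin-singlet operator
`pairChirality L x = I • (P₁(x)ᴴ P₂(x) - P₂(x)ᴴ P₁(x))` and `totalPairChirality L = Σ_x pairChirality L x`.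
It is the second-quantised lattice version of the composite bilinear `φ₂ = η† τ² η = i (η₁ η₂* - η₂ η₁*)`
of a two-component pairing field `η = (η₁, η₂)` (Fernandes–Orth–Schmalian 2019, §2.1): for the
doublet `(d_{x²-y²}, d_xy) = (B₁g, B₂g)` of the square lattice it transforms as `B₁g ⊗ B₂g = A₂g`,
is odd under time reversal, and is the `ℤ₂` (Ising) order parameter of the chiral
`d_{x²-y²} ± i d_xy` paired state (`⟨O_χ⟩ ∝ |η₁| |η₂| sin(φ₁ - φ₂)`).

## Contents (all proved)

* definitions `pairChirality`, `totalPairChirality` (and the two-site singlet pair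
  `PairChirality.bond u v = c_{u↑} c_{v↓} - c_{u↓} c_{v↑}` on an arbitrary finite lattice, of which
  `singletBond` is the torus-bond specialisation, `rfl`);
* unfolding: `totalPairChirality_eq_sum`, and the `let B; let P₂; let P₁; let X`-form used verbatim by
  the route files of `Summits/HubbardSuperconductivity` (`PairChirality.let_sum_eq_totalPairChirality`,
  `PairChirality.le_expect_iff`, `PairChirality.le_gibbsState_iff`, via
  `localPairOn_diagSteps_dxyFormFactor`);
* hermiticity (`isHermitian_pairChirality`, `isHermitian_totalPairChirality`);
* `U(1)` neutrality and `S^z = 0`: `pairChirality` conserves `N↑` and `N↓`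
  (`preservesSectors_pairChirality`), hence commutes with `totalNumber` and `spinZ`; spin singlet:
  it commutes with `S⁺` and `S⁻` (`spinPlus_commute_pairChirality`, …) and therefore with `S²`;
* time-reversal oddness in the occupation basis: all Jordan–Wigner matrices are real, so entrywise
  complex conjugation flips the sign of `pairChirality` (`pairChirality_map_conj`), whence
  `⟨ψ, O_χ(x) ψ⟩ = 0` for every REAL vector `ψ` (`expect_pairChirality_eq_zero_of_star_eq`); the
  two-point quantity `⟨ψ, Xᴴ X ψ⟩` is not constrained (this is why routes measure `Xᴴ X`).

The `D₄` covariance (`A₂g`) is proved in the companion file `PairChiralityD4Proofs`.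

## Design notes

* `P₂` is `localPairOn diagSteps dxyFormFactor` (a `Finset` sum); the route files inline the
  expanded four-bond combination, and `localPairOn_diagSteps_dxyFormFactor` (`LocalPairOn`) is the
  bridge used by the unfolding lemmas.
* The algebraic lemmas (grading by `(N↑, N↓)`, commutation with `S^±`, reality) are proved for
  `localPairOn S g` with an arbitrary step set `S` and form factor `g`, so they serve `P₁`
  (`S = {0} ∪ unitSteps`, `localPair = localPairOn (insert 0 unitSteps)` by `rfl`) and `P₂` alike.
* Helper vocabulary lives in the sub-namespace `PairChirality`.

## Sources

R. M. Fernandes, P. P. Orth, J. Schmalian, Annu. Rev. Condens. Matter Phys. 10 (2019) 133, §2.1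
(composite bilinears `φ_i = η† τ^i η`; `φ₂` is `A₂g`, time-reversal odd, a `ℤ₂` order parameter)
[FernandesOrthSchmalian2019]; T. Xiang, C. Wu, *D-wave Superconductivity* (CUP 2022), §1.14
eq. (1.134)–(1.135) (`d_{x²-y²}` and `d_xy` form factors; `p_x ± i p_y`-type combinations break time
reversal) and §11.2 (`B₁g` carries `d_{x²-y²}`, `B₂g` carries `d_xy`) [XiangWu2022];
D. J. Scalapino, Phys. Rep. 250 (1995) 329, §2 [Scalapino1995]; H. Tasaki, *Physics and
Mathematics of Quantum Many-Body Systems* (2020), §9.3 (fermion bilinears, spin operators) [Tasaki2020].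
-/

noncomputable section

namespace Literature.MathematicalPhysics.QuantumLattice

open Matrix Finset Literature.Probability.LatticeModels
open scoped ComplexOrder

/-! ### The two-site singlet pair and the pair-chirality density -/

namespace PairChirality

section Bond

variable {Λ : Type*} [LinearOrder Λ] [Fintype Λ]

/-- The two-site singlet pair annihilator `b_{uv} = c_{u↑} c_{v↓} - c_{u↓} c_{v↑}` of an arbitrary
finite lattice `Λ` (the summand of `localPair`/`localPairOn`; `singletBond L x e` is the case
`u = x`, `v = x + e` on the torus, `singletBond_eq_bond`).
Scalapino, Phys. Rep. 250 (1995) 329, §2, eq. (2.2). [folklore] -/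
def bond (u v : Λ) : Matrix (Finset (Orb Λ)) (Finset (Orb Λ)) ℂ :=
  annihilation (orb u 0) * annihilation (orb v 1) - annihilation (orb u 1) * annihilation (orb v 0)

end Bond

variable (L : ℕ) [NeZero L]

/-- `singletBond L x e = b_{x, x+e}` (definitional). Scalapino (1995) §2, eq. (2.2). [folklore] -/
theorem singletBond_eq_bond (x : TorusSite 2 L) (e : Site 2) :
    singletBond L x e =
      bond (FermionTorus.ofTorusSite x) (FermionTorus.ofTorusSite (x + Torus.proj L e)) :=
  rfl

/-- `localPairOn S g L x = Σ_{e ∈ S} (g e/√2) • b_{x, x+e}` (definitional).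
Scalapino (1995) §2, eq. (2.2)–(2.3). [folklore] -/
theorem localPairOn_eq_sum_bond (S : Finset (Site 2)) (g : Site 2 → ℝ) (x : TorusSite 2 L) :
    localPairOn S g L x = ∑ e ∈ S, ((g e / Real.sqrt 2 : ℝ) : ℂ) •
      bond (FermionTorus.ofTorusSite x) (FermionTorus.ofTorusSite (x + Torus.proj L e)) :=
  rfl

end PairChirality

section Defs

variable (L : ℕ) [NeZero L]

/-- The **pair-chirality density** `O_χ(x) = i (P₁(x)ᴴ P₂(x) - P₂(x)ᴴ P₁(x))` at the torus site
`x`, with `P₁ = localPair dWaveFormFactor L x` (`B₁g` nearest-neighbour singlet pair) and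
`P₂ = localPairOn diagSteps dxyFormFactor L x` (`B₂g` diagonal singlet pair): the lattice operator
version of the
composite bilinear `φ₂ = η† τ² η = i(η₁ η₂* - η₂ η₁*)` of the two-component pairing field
`η = (P₁, P₂)`, the time-reversal-odd `A₂g` (`ℤ₂`, Ising) order parameter of a `d_{x²-y²} ± i d_xy`
state. Fernandes–Orth–Schmalian, Annu. Rev. CMP 10 (2019) 133, §2.1. [cite: FernandesOrthSchmalian2019, §2.1] -/
def pairChirality (x : TorusSite 2 L) :
    Matrix (Finset (Orb (FermionTorus 2 L))) (Finset (Orb (FermionTorus 2 L))) ℂ :=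
  Complex.I • ((localPair dWaveFormFactor L x)ᴴ * localPairOn diagSteps dxyFormFactor L x -
    (localPairOn diagSteps dxyFormFactor L x)ᴴ * localPair dWaveFormFactor L x)

/-- The total pair chirality `X_L = Σ_x O_χ(x)` of the torus of side `L` (the order parameter whose
two-point functional `L⁻⁴ ⟨X_Lᴴ X_L⟩` measures chiral `d ± i d'` order).
Fernandes–Orth–Schmalian, Annu. Rev. CMP 10 (2019) 133, §2.1. [cite: FernandesOrthSchmalian2019, §2.1] -/
def totalPairChirality :
    Matrix (Finset (Orb (FermionTorus 2 L))) (Finset (Orb (FermionTorus 2 L))) ℂ :=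
  ∑ x : TorusSite 2 L, pairChirality L x

end Defs

/-! ### Unfolding lemmas -/

section Unfold

variable (L : ℕ) [NeZero L]

/-- `X_L` unfolded. [folklore] -/
theorem totalPairChirality_eq_sum :
    totalPairChirality L = ∑ x : TorusSite 2 L, Complex.I •
      ((localPair dWaveFormFactor L x)ᴴ * localPairOn diagSteps dxyFormFactor L x -
        (localPairOn diagSteps dxyFormFactor L x)ᴴ * localPair dWaveFormFactor L x) :=
  rfl

/-- `O_χ(x)` with the `d_{xy}` pair expanded into its four bonds
(`localPairOn_diagSteps_dxyFormFactor`). [folklore] -/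
theorem pairChirality_eq_singletBond (x : TorusSite 2 L) :
    pairChirality L x = Complex.I •
      ((localPair dWaveFormFactor L x)ᴴ * (((1 / Real.sqrt 2 : ℝ) : ℂ) •
          (singletBond L x ![1, 1] + singletBond L x ![-1, -1] - singletBond L x ![1, -1] -
            singletBond L x ![-1, 1])) -
        (((1 / Real.sqrt 2 : ℝ) : ℂ) •
          (singletBond L x ![1, 1] + singletBond L x ![-1, -1] - singletBond L x ![1, -1] -
            singletBond L x ![-1, 1]))ᴴ * localPair dWaveFormFactor L x) := by
  rw [pairChirality, localPairOn_diagSteps_dxyFormFactor]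

/-- The `let B; let P₂; let P₁; ∑ x, …` term inlined in the route files of
`Summits/HubbardSuperconductivity` (route `VestigialChirality`) equals `totalPairChirality L`
(by `localPairOn_diagSteps_dxyFormFactor`; the `let`-bound `B x e` is `singletBond L x e`). [folklore] -/
theorem PairChirality.let_sum_eq_totalPairChirality :
    (let B := fun (x : TorusSite 2 L) (e : Site 2) =>
      annihilation (orb (FermionTorus.ofTorusSite x) 0) *
          annihilation (orb (FermionTorus.ofTorusSite (x + Torus.proj L e)) 1) -
        annihilation (orb (FermionTorus.ofTorusSite x) 1) *
          annihilation (orb (FermionTorus.ofTorusSite (x + Torus.proj L e)) 0)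
    let P₂ := fun (x : TorusSite 2 L) =>
      ((1 / Real.sqrt 2 : ℝ) : ℂ) • (B x ![1, 1] + B x ![-1, -1] - B x ![1, -1] - B x ![-1, 1])
    let P₁ := fun (x : TorusSite 2 L) => localPair dWaveFormFactor L x
    ∑ x : TorusSite 2 L, Complex.I • (Matrix.conjTranspose (P₁ x) * P₂ x -
      Matrix.conjTranspose (P₂ x) * P₁ x)) = totalPairChirality L := by
  simp only [totalPairChirality, pairChirality_eq_singletBond, singletBond]

/-- Ground-state form of the route statements: the inlined `let`-block inequality
`c ≤ L⁻⁴ re ⟨ψ, Xᴴ X ψ⟩` is `c ≤ L⁻⁴ re ⟨ψ, (X_L)ᴴ X_L ψ⟩` with `X_L = totalPairChirality L`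
(so the route items can be re-set to the short form without change of meaning). [folklore] -/
theorem PairChirality.le_expect_iff (ψ : Fock (Orb (FermionTorus 2 L))) (c : ℝ) :
    (let B := fun (x : TorusSite 2 L) (e : Site 2) =>
      annihilation (orb (FermionTorus.ofTorusSite x) 0) *
          annihilation (orb (FermionTorus.ofTorusSite (x + Torus.proj L e)) 1) -
        annihilation (orb (FermionTorus.ofTorusSite x) 1) *
          annihilation (orb (FermionTorus.ofTorusSite (x + Torus.proj L e)) 0)
    let P₂ := fun (x : TorusSite 2 L) =>
      ((1 / Real.sqrt 2 : ℝ) : ℂ) • (B x ![1, 1] + B x ![-1, -1] - B x ![1, -1] - B x ![-1, 1])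
    let P₁ := fun (x : TorusSite 2 L) => localPair dWaveFormFactor L x
    let X := ∑ x : TorusSite 2 L, Complex.I • (Matrix.conjTranspose (P₁ x) * P₂ x -
      Matrix.conjTranspose (P₂ x) * P₁ x)
    c ≤ (expect (Matrix.conjTranspose X * X) ψ).re / ((L : ℕ) : ℝ) ^ 4) ↔
      c ≤ (expect ((totalPairChirality L)ᴴ * totalPairChirality L) ψ).re / ((L : ℕ) : ℝ) ^ 4 := by
  simp only [totalPairChirality, pairChirality_eq_singletBond, singletBond]

/-- Thermal form of the route statements: the inlined `let`-block inequality
`c ≤ L⁻⁴ re ⟨Xᴴ X⟩_{β,H}` is `c ≤ L⁻⁴ re ⟨(X_L)ᴴ X_L⟩_{β,H}`. [folklore] -/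
theorem PairChirality.le_gibbsState_iff (β : ℝ)
    (H : Matrix (Finset (Orb (FermionTorus 2 L))) (Finset (Orb (FermionTorus 2 L))) ℂ) (c : ℝ) :
    (let B := fun (x : TorusSite 2 L) (e : Site 2) =>
      annihilation (orb (FermionTorus.ofTorusSite x) 0) *
          annihilation (orb (FermionTorus.ofTorusSite (x + Torus.proj L e)) 1) -
        annihilation (orb (FermionTorus.ofTorusSite x) 1) *
          annihilation (orb (FermionTorus.ofTorusSite (x + Torus.proj L e)) 0)
    let P₂ := fun (x : TorusSite 2 L) =>
      ((1 / Real.sqrt 2 : ℝ) : ℂ) • (B x ![1, 1] + B x ![-1, -1] - B x ![1, -1] - B x ![-1, 1])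
    let P₁ := fun (x : TorusSite 2 L) => localPair dWaveFormFactor L x
    let X := ∑ x : TorusSite 2 L, Complex.I • (Matrix.conjTranspose (P₁ x) * P₂ x -
      Matrix.conjTranspose (P₂ x) * P₁ x)
    c ≤ (Matrix.gibbsState β H (Matrix.conjTranspose X * X)).re / ((L : ℕ) : ℝ) ^ 4) ↔
      c ≤ (Matrix.gibbsState β H ((totalPairChirality L)ᴴ * totalPairChirality L)).re /
        ((L : ℕ) : ℝ) ^ 4 := by
  simp only [totalPairChirality, pairChirality_eq_singletBond, singletBond]

end Unfold

/-! ### Hermiticity -/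

section Hermitian

variable (L : ℕ) [NeZero L]

/-- `O_χ(x)` is Hermitian: `(i(A - Aᴴ))ᴴ = i(A - Aᴴ)` with `A = P₁ᴴ P₂`.
Fernandes–Orth–Schmalian (2019) §2.1 (the bilinears `η† τ^i η` are real). [folklore] -/
theorem isHermitian_pairChirality (x : TorusSite 2 L) : (pairChirality L x).IsHermitian := by
  rw [IsHermitian, pairChirality, conjTranspose_smul, conjTranspose_sub, conjTranspose_mul,
    conjTranspose_mul, conjTranspose_conjTranspose, conjTranspose_conjTranspose, Complex.star_def,
    Complex.conj_I, neg_smul, ← smul_neg, neg_sub]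

/-- `X_L` is Hermitian. [folklore] -/
theorem isHermitian_totalPairChirality : (totalPairChirality L).IsHermitian := by
  rw [IsHermitian, totalPairChirality, conjTranspose_sum]
  exact Finset.sum_congr rfl fun x _ => (isHermitian_pairChirality L x).eq

end Hermitian

/-! ### Charge neutrality and `S^z = 0`: `O_χ` conserves `N↑` and `N↓` -/

namespace PairChirality

section Shifts

variable {Λ : Type*} [LinearOrder Λ] [Fintype Λ]

/-- `M` shifts the spin-resolved particle numbers by `(a, b) ∈ ℤ²`: a nonzero entry `M s t` has
`N↑(s) = N↑(t) + a` and `N↓(s) = N↓(t) + b` (grading of Fock-space operators by `(N↑, N↓)`;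
`(0, 0)` is `PreservesSectors`). Tasaki (2020) §9.3. [folklore] -/
def Shifts (a b : ℤ) (M : Matrix (Finset (Orb Λ)) (Finset (Orb Λ)) ℂ) : Prop :=
  ∀ s t, M s t ≠ 0 →
    ((upPart s).card : ℤ) = (upPart t).card + a ∧ ((downPart s).card : ℤ) = (downPart t).card + b

/-- Grade `(0, 0)` is `PreservesSectors`. [folklore] -/
theorem Shifts.preservesSectors {M : Matrix (Finset (Orb Λ)) (Finset (Orb Λ)) ℂ}
    (h : Shifts 0 0 M) : PreservesSectors M := fun s t hst => by
  have h' := h s t hst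
  simp only [add_zero, Nat.cast_inj] at h'
  exact h'

/-- `0` has every grade. [folklore] -/
theorem Shifts.zero (a b : ℤ) : Shifts a b (0 : Matrix (Finset (Orb Λ)) (Finset (Orb Λ)) ℂ) :=
  fun _ _ h => absurd rfl h

/-- Grades are stable under addition. [folklore] -/
theorem Shifts.add {a b : ℤ} {M N : Matrix (Finset (Orb Λ)) (Finset (Orb Λ)) ℂ}
    (hM : Shifts a b M) (hN : Shifts a b N) : Shifts a b (M + N) := by
  intro s t h
  by_cases hMs : M s t = 0
  · rw [Matrix.add_apply, hMs, zero_add] at h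
    exact hN s t h
  · exact hM s t hMs

/-- Grades are stable under negation. [folklore] -/
theorem Shifts.neg {a b : ℤ} {M : Matrix (Finset (Orb Λ)) (Finset (Orb Λ)) ℂ}
    (hM : Shifts a b M) : Shifts a b (-M) :=
  fun s t h => hM s t fun h' => h (by rw [Matrix.neg_apply, h', neg_zero])

/-- Grades are stable under subtraction. [folklore] -/
theorem Shifts.sub {a b : ℤ} {M N : Matrix (Finset (Orb Λ)) (Finset (Orb Λ)) ℂ}
    (hM : Shifts a b M) (hN : Shifts a b N) : Shifts a b (M - N) := by
  rw [sub_eq_add_neg]; exact hM.add hN.neg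

/-- Grades are stable under scalars. [folklore] -/
theorem Shifts.smul {a b : ℤ} {M : Matrix (Finset (Orb Λ)) (Finset (Orb Λ)) ℂ}
    (hM : Shifts a b M) (c : ℂ) : Shifts a b (c • M) :=
  fun s t h => hM s t fun h' => h (by rw [Matrix.smul_apply, h', smul_zero])

/-- Grades are stable under finite sums. [folklore] -/
theorem Shifts.sum {a b : ℤ} {ι : Type*} {S : Finset ι}
    {M : ι → Matrix (Finset (Orb Λ)) (Finset (Orb Λ)) ℂ} (hM : ∀ i ∈ S, Shifts a b (M i)) :
    Shifts a b (∑ i ∈ S, M i) := by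
  classical
  induction S using Finset.induction_on with
  | empty => rw [sum_empty]; exact Shifts.zero a b
  | @insert i S hi ih =>
    rw [sum_insert hi]
    exact (hM i (mem_insert_self i S)).add (ih fun j hj => hM j (mem_insert_of_mem hj))

/-- Grades add under products. [folklore] -/
theorem Shifts.mul {a b a' b' : ℤ} {M N : Matrix (Finset (Orb Λ)) (Finset (Orb Λ)) ℂ}
    (hM : Shifts a b M) (hN : Shifts a' b' N) : Shifts (a + a') (b + b') (M * N) := by
  intro s u h
  rw [Matrix.mul_apply] at h
  obtain ⟨t, -, ht⟩ := Finset.exists_ne_zero_of_sum_ne_zero h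
  have h1 := hM s t (left_ne_zero_of_mul ht)
  have h2 := hN t u (right_ne_zero_of_mul ht)
  omega

/-- The adjoint has the opposite grade. [folklore] -/
theorem Shifts.conjTranspose {a b : ℤ} {M : Matrix (Finset (Orb Λ)) (Finset (Orb Λ)) ℂ}
    (hM : Shifts a b M) : Shifts (-a) (-b) Mᴴ := by
  intro s t h
  rw [conjTranspose_apply, ne_eq, star_eq_zero] at h
  have := hM t s h
  omega

/-- `c_{x↑}` removes an up electron: grade `(-1, 0)`. Tasaki (2020) §9.3. [folklore] -/
theorem shifts_annihilation_up (x : Λ) :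
    Shifts (-1) 0 (annihilation (orb x 0) : Matrix (Finset (Orb Λ)) (Finset (Orb Λ)) ℂ) := by
  intro s t h
  simp only [annihilation, ne_eq, ite_eq_right_iff, Classical.not_imp] at h
  obtain ⟨⟨hx, rfl⟩, -⟩ := h
  obtain ⟨α, β, rfl⟩ : ∃ α β, s = pairSet α β :=
    ⟨upPart s, downPart s, (pairSet_upPart_downPart s).symm⟩
  rw [orb_zero_mem_pairSet] at hx
  rw [pairSet_insert_zero, upPart_pairSet, downPart_pairSet, upPart_pairSet, downPart_pairSet,
    card_insert_of_notMem hx]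
  omega

/-- `c_{x↓}` removes a down electron: grade `(0, -1)`. Tasaki (2020) §9.3. [folklore] -/
theorem shifts_annihilation_down (x : Λ) :
    Shifts 0 (-1) (annihilation (orb x 1) : Matrix (Finset (Orb Λ)) (Finset (Orb Λ)) ℂ) := by
  intro s t h
  simp only [annihilation, ne_eq, ite_eq_right_iff, Classical.not_imp] at h
  obtain ⟨⟨hx, rfl⟩, -⟩ := h
  obtain ⟨α, β, rfl⟩ : ∃ α β, s = pairSet α β :=
    ⟨upPart s, downPart s, (pairSet_upPart_downPart s).symm⟩
  rw [orb_one_mem_pairSet] at hx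
  rw [pairSet_insert_one, upPart_pairSet, downPart_pairSet, upPart_pairSet, downPart_pairSet,
    card_insert_of_notMem hx]
  omega

/-- A singlet bond pair removes one up and one down electron: grade `(-1, -1)`. [folklore] -/
theorem shifts_bond (u v : Λ) : Shifts (-1) (-1) (bond u v) := by
  have h1 := (shifts_annihilation_up u).mul (shifts_annihilation_down v)
  have h2 := (shifts_annihilation_down u).mul (shifts_annihilation_up v)
  simp only [Int.reduceNeg, add_zero, zero_add] at h1 h2
  exact h1.sub h2

end Shifts

section Sectors

variable (L : ℕ) [NeZero L]

/-- `localPairOn S g L x` has grade `(-1, -1)` (every singlet bond removes one up and one down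
electron). [folklore] -/
theorem shifts_localPairOn (S : Finset (Site 2)) (g : Site 2 → ℝ) (x : TorusSite 2 L) :
    Shifts (-1) (-1) (localPairOn S g L x) := by
  rw [localPairOn_eq_sum_bond]
  exact Shifts.sum fun e _ => (shifts_bond _ _).smul _

/-- `P_g(x) = localPair g L x` has grade `(-1, -1)`. [folklore] -/
theorem shifts_localPair (g : Site 2 → ℝ) (x : TorusSite 2 L) : Shifts (-1) (-1) (localPair g L x) :=
  shifts_localPairOn L (insert 0 unitSteps) g x

end Sectors

end PairChirality

section Neutral

variable (L : ℕ) [NeZero L]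

open PairChirality

/-- **Charge neutrality / `S^z = 0`**: `O_χ(x)` conserves the numbers of up and of down electrons
(each monomial has two creators and two annihilators, one of each spin). Fernandes–Orth–Schmalian
(2019) §2.1 (the composite order parameter is neutral). [folklore] -/
theorem preservesSectors_pairChirality (x : TorusSite 2 L) : PreservesSectors (pairChirality L x) := by
  have h1 := (shifts_localPair L dWaveFormFactor x).conjTranspose.mul
    (shifts_localPairOn L diagSteps dxyFormFactor x)
  have h2 := (shifts_localPairOn L diagSteps dxyFormFactor x).conjTranspose.mul
    (shifts_localPair L dWaveFormFactor x)
  simp only [Int.reduceNeg, neg_neg, add_neg_cancel] at h1 h2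
  exact ((h1.sub h2).smul Complex.I).preservesSectors

/-- `X_L` conserves `N↑` and `N↓`. [folklore] -/
theorem preservesSectors_totalPairChirality : PreservesSectors (totalPairChirality L) :=
  PreservesSectors.sum fun x _ => preservesSectors_pairChirality L x

/-- `[O_χ(x), N] = 0` (`U(1)` neutrality). Fernandes–Orth–Schmalian (2019) §2.1. [folklore] -/
theorem pairChirality_commute_totalNumber (x : TorusSite 2 L) :
    Commute (pairChirality L x) totalNumber := by
  rw [LiebThm1.totalNumber_eq_diagonal]
  exact (preservesSectors_pairChirality L x).commute_diagonal fun a b => ((a + b : ℕ) : ℂ)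

/-- `[X_L, N] = 0`. [folklore] -/
theorem totalPairChirality_commute_totalNumber : Commute (totalPairChirality L) totalNumber := by
  rw [LiebThm1.totalNumber_eq_diagonal]
  exact (preservesSectors_totalPairChirality L).commute_diagonal fun a b => ((a + b : ℕ) : ℂ)

/-- `[O_χ(x), S^z] = 0`. Tasaki (2020) §9.3. [folklore] -/
theorem pairChirality_commute_spinZ (x : TorusSite 2 L) :
    Commute (pairChirality L x) HubbardWave0.spinZ := by
  rw [LiebThm1.spinZ_eq_diagonal]
  exact (preservesSectors_pairChirality L x).commute_diagonal
    fun a b => (1 / 2 : ℂ) * ((a : ℂ) - (b : ℂ))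

/-- `[X_L, S^z] = 0`. [folklore] -/
theorem totalPairChirality_commute_spinZ : Commute (totalPairChirality L) HubbardWave0.spinZ := by
  rw [LiebThm1.spinZ_eq_diagonal]
  exact (preservesSectors_totalPairChirality L).commute_diagonal
    fun a b => (1 / 2 : ℂ) * ((a : ℂ) - (b : ℂ))

end Neutral

/-! ### Spin singlet: `O_χ` commutes with `S⁺` and `S⁻` -/

namespace PairChirality

section Singlet

variable {Λ : Type*} [LinearOrder Λ] [Fintype Λ]

/-- `[c†_a c_b, c_p c_q] = δ_{ap} c_q c_b - δ_{aq} c_p c_b` (adjoint of `hop_pair_commutator`).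
Tasaki (2020) §9.3 (commutators of fermion bilinears). [folklore] -/
theorem hop_pairAnnihilation_commutator (a b p q : Orb Λ) :
    creation a * annihilation b * (annihilation p * annihilation q) -
        annihilation p * annihilation q * (creation a * annihilation b) =
      (if a = p then annihilation q * annihilation b else 0) -
        (if a = q then annihilation p * annihilation b else 0) := by
  have h := congrArg Matrix.conjTranspose (hop_pair_commutator b a q p)
  simp only [conjTranspose_sub, conjTranspose_mul, creation_conjTranspose,
    annihilation_conjTranspose, apply_ite Matrix.conjTranspose, conjTranspose_zero] at h
  calc creation a * annihilation b * (annihilation p * annihilation q) -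
        annihilation p * annihilation q * (creation a * annihilation b)
      = -(annihilation p * annihilation q * (creation a * annihilation b) -
          creation a * annihilation b * (annihilation p * annihilation q)) := by abel
    _ = -((if a = q then annihilation p * annihilation b else 0) -
          (if a = p then annihilation q * annihilation b else 0)) := by rw [h]
    _ = _ := by abel

/-- `[S⁺, b_{uv}] = 0`: termwise `[c†_{z↑} c_{z↓}, b_{uv}] = δ_{zu} c_{v↓} c_{z↓} + δ_{zv} c_{u↓} c_{z↓}`,
and the sum over `z` is the anticommutator `{c_{v↓}, c_{u↓}} = 0`. Tasaki (2020) §9.3. [folklore] -/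
theorem spinPlus_commute_bond (u v : Λ) : Commute spinPlus (bond u v) := by
  have h01 : ∀ z w : Λ, orb z 0 ≠ orb w 1 := fun z w h => absurd (orb_eq_orb_iff.1 h).2 (by decide)
  have key : ∀ z : Λ,
      creation (orb z 0) * annihilation (orb z 1) * bond u v -
          bond u v * (creation (orb z 0) * annihilation (orb z 1)) =
        (if z = u then annihilation (orb v 1) * annihilation (orb z 1) else 0) +
          (if z = v then annihilation (orb u 1) * annihilation (orb z 1) else 0) := by
    intro z
    rw [bond, mul_sub, sub_mul, sub_sub_sub_comm, hop_pairAnnihilation_commutator,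
      hop_pairAnnihilation_commutator, if_neg (h01 z v), if_neg (h01 z u)]
    by_cases hzu : z = u
    · subst hzu
      by_cases hzv : z = v
      · subst hzv; simp
      · rw [if_pos rfl, if_pos rfl, if_neg (fun h => hzv (orb_eq_orb_iff.1 h).1), if_neg hzv]
        abel
    · rw [if_neg (fun h => hzu (orb_eq_orb_iff.1 h).1), if_neg hzu]
      by_cases hzv : z = v
      · subst hzv; rw [if_pos rfl, if_pos rfl]; abel
      · rw [if_neg (fun h => hzv (orb_eq_orb_iff.1 h).1), if_neg hzv]; abel
  rw [Commute, SemiconjBy, ← sub_eq_zero, spinPlus, Finset.sum_mul, Finset.mul_sum,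
    ← Finset.sum_sub_distrib, Finset.sum_congr rfl fun z _ => key z, Finset.sum_add_distrib,
    Finset.sum_ite_eq', Finset.sum_ite_eq', if_pos (Finset.mem_univ _),
    if_pos (Finset.mem_univ _)]
  exact annihilation_anticommute_holds _ _

/-- `[S⁻, b_{uv}] = 0` (same computation with `↑`, `↓` exchanged). Tasaki (2020) §9.3. [folklore] -/
theorem spinMinus_commute_bond (u v : Λ) : Commute spinMinus (bond u v) := by
  have h10 : ∀ z w : Λ, orb z 1 ≠ orb w 0 := fun z w h => absurd (orb_eq_orb_iff.1 h).2 (by decide)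
  have key : ∀ z : Λ,
      creation (orb z 1) * annihilation (orb z 0) * bond u v -
          bond u v * (creation (orb z 1) * annihilation (orb z 0)) =
        -(if z = v then annihilation (orb u 0) * annihilation (orb z 0) else 0) -
          (if z = u then annihilation (orb v 0) * annihilation (orb z 0) else 0) := by
    intro z
    rw [bond, mul_sub, sub_mul, sub_sub_sub_comm, hop_pairAnnihilation_commutator,
      hop_pairAnnihilation_commutator, if_neg (h10 z u), if_neg (h10 z v)]
    by_cases hzu : z = u
    · subst hzu
      by_cases hzv : z = v
      · subst hzv; simp
      · rw [if_pos rfl, if_pos rfl, if_neg (fun h => hzv (orb_eq_orb_iff.1 h).1), if_neg hzv]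
        abel
    · rw [if_neg (fun h => hzu (orb_eq_orb_iff.1 h).1), if_neg hzu]
      by_cases hzv : z = v
      · subst hzv; rw [if_pos rfl, if_pos rfl]; abel
      · rw [if_neg (fun h => hzv (orb_eq_orb_iff.1 h).1), if_neg hzv]; abel
  rw [Commute, SemiconjBy, ← sub_eq_zero, spinMinus_eq_sum, Finset.sum_mul, Finset.mul_sum,
    ← Finset.sum_sub_distrib, Finset.sum_congr rfl fun z _ => key z, Finset.sum_sub_distrib,
    Finset.sum_neg_distrib, Finset.sum_ite_eq', Finset.sum_ite_eq', if_pos (Finset.mem_univ _),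
    if_pos (Finset.mem_univ _), neg_sub_left, neg_eq_zero]
  exact annihilation_anticommute_holds _ _

/-- `[S⁺, (b_{uv})ᴴ] = 0` (adjoint of `[S⁻, b_{uv}] = 0`, since `(S⁻)ᴴ = S⁺`). Tasaki (2020) §9.3. [folklore] -/
theorem spinPlus_commute_bond_conjTranspose (u v : Λ) : Commute spinPlus (bond u v)ᴴ := by
  have h := (spinMinus_commute_bond u v).star_star
  rwa [star_eq_conjTranspose, star_eq_conjTranspose, spinMinus, conjTranspose_conjTranspose] at h

/-- `[S⁻, (b_{uv})ᴴ] = 0` (adjoint of `[S⁺, b_{uv}] = 0`). Tasaki (2020) §9.3. [folklore] -/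
theorem spinMinus_commute_bond_conjTranspose (u v : Λ) : Commute spinMinus (bond u v)ᴴ := by
  have h := (spinPlus_commute_bond u v).star_star
  rwa [star_eq_conjTranspose, star_eq_conjTranspose] at h

variable (L : ℕ) [NeZero L]

/-- `S⁺` and `S⁻` commute with `localPairOn S g L x` and with its adjoint (every step set `S`,
every form factor `g`). Tasaki (2020) §9.3. [folklore] -/
theorem spin_commute_localPairOn (S : Finset (Site 2)) (g : Site 2 → ℝ) (x : TorusSite 2 L) :
    Commute spinPlus (localPairOn S g L x) ∧ Commute spinMinus (localPairOn S g L x) ∧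
      Commute spinPlus (localPairOn S g L x)ᴴ ∧ Commute spinMinus (localPairOn S g L x)ᴴ := by
  rw [localPairOn_eq_sum_bond, conjTranspose_sum]
  refine ⟨?_, ?_, ?_, ?_⟩
  · exact Commute.sum_right _ _ _ fun e _ => (spinPlus_commute_bond _ _).smul_right _
  · exact Commute.sum_right _ _ _ fun e _ => (spinMinus_commute_bond _ _).smul_right _
  · refine Commute.sum_right _ _ _ fun e _ => ?_
    rw [conjTranspose_smul]
    exact (spinPlus_commute_bond_conjTranspose _ _).smul_right _
  · refine Commute.sum_right _ _ _ fun e _ => ?_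
    rw [conjTranspose_smul]
    exact (spinMinus_commute_bond_conjTranspose _ _).smul_right _

/-- `S⁺` and `S⁻` commute with `P_g(x) = localPair g L x` and its adjoint. [folklore] -/
theorem spin_commute_localPair (g : Site 2 → ℝ) (x : TorusSite 2 L) :
    Commute spinPlus (localPair g L x) ∧ Commute spinMinus (localPair g L x) ∧
      Commute spinPlus (localPair g L x)ᴴ ∧ Commute spinMinus (localPair g L x)ᴴ :=
  spin_commute_localPairOn L (insert 0 unitSteps) g x

end Singlet

end PairChirality

section Singlet

variable (L : ℕ) [NeZero L]

open PairChirality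

/-- **Spin singlet**: `[S⁺, O_χ(x)] = 0`. Tasaki (2020) §9.3; Fernandes–Orth–Schmalian (2019) §2.1. [folklore] -/
theorem spinPlus_commute_pairChirality (x : TorusSite 2 L) : Commute spinPlus (pairChirality L x) := by
  obtain ⟨h2, -, h2', -⟩ := spin_commute_localPairOn L diagSteps dxyFormFactor x
  obtain ⟨h1, -, h1', -⟩ := spin_commute_localPair L dWaveFormFactor x
  exact ((h1'.mul_right h2).sub_right (h2'.mul_right h1)).smul_right _

/-- `[S⁻, O_χ(x)] = 0`. Tasaki (2020) §9.3. [folklore] -/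
theorem spinMinus_commute_pairChirality (x : TorusSite 2 L) : Commute spinMinus (pairChirality L x) := by
  obtain ⟨-, h2, -, h2'⟩ := spin_commute_localPairOn L diagSteps dxyFormFactor x
  obtain ⟨-, h1, -, h1'⟩ := spin_commute_localPair L dWaveFormFactor x
  exact ((h1'.mul_right h2).sub_right (h2'.mul_right h1)).smul_right _

/-- `[S², O_χ(x)] = 0` (`S² = (S^z)² + ½(S⁺S⁻ + S⁻S⁺)`). Tasaki (2020) §9.3. [folklore] -/
theorem spinSq_commute_pairChirality (x : TorusSite 2 L) : Commute spinSq (pairChirality L x) := by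
  have hP := spinPlus_commute_pairChirality L x
  have hM := spinMinus_commute_pairChirality L x
  have hZ := (pairChirality_commute_spinZ L x).symm
  rw [spinSq]
  exact (hZ.mul_left hZ).add_left (((hP.mul_left hM).add_left (hM.mul_left hP)).smul_left _)

/-- `[S⁺, X_L] = 0`, `[S⁻, X_L] = 0`, `[S², X_L] = 0`. [folklore] -/
theorem spin_commute_totalPairChirality :
    Commute spinPlus (totalPairChirality L) ∧ Commute spinMinus (totalPairChirality L) ∧
      Commute spinSq (totalPairChirality L) :=
  ⟨Commute.sum_right _ _ _ fun x _ => spinPlus_commute_pairChirality L x,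
    Commute.sum_right _ _ _ fun x _ => spinMinus_commute_pairChirality L x,
    Commute.sum_right _ _ _ fun x _ => spinSq_commute_pairChirality L x⟩

end Singlet

/-! ### Time-reversal oddness in the (real) occupation basis -/

namespace PairChirality

section Real

variable {ι : Type*} [LinearOrder ι]

/-- The Jordan–Wigner annihilation matrices are real. Tasaki (2020) §9.2. [folklore] -/
theorem annihilation_map_conj (i : ι) :
    (annihilation i).map (starRingEnd ℂ) = annihilation i := by
  ext s t
  simp only [map_apply, annihilation, jwSign, apply_ite (starRingEnd ℂ), map_pow, map_neg, map_one,
    map_zero]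

/-- The Jordan–Wigner creation matrices are real. Tasaki (2020) §9.2. [folklore] -/
theorem creation_map_conj (i : ι) :
    (creation i).map (starRingEnd ℂ) = creation i := by
  rw [creation, conjTranspose_map (starRingEnd ℂ) (fun _ => rfl), annihilation_map_conj]

end Real

/-- Entrywise conjugation commutes with the adjoint (complex matrices). [folklore] -/
theorem conjTranspose_map_conj {m : Type*} (M : Matrix m m ℂ) :
    Mᴴ.map (starRingEnd ℂ) = (M.map (starRingEnd ℂ))ᴴ :=
  conjTranspose_map (starRingEnd ℂ) fun _ => rfl

section RealHubbard

variable {Λ : Type*} [LinearOrder Λ] [Fintype Λ]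

/-- Singlet bond pairs are real matrices. [folklore] -/
theorem bond_map_conj (u v : Λ) : (bond u v).map (starRingEnd ℂ) = bond u v := by
  simp only [bond, ← RingHom.mapMatrix_apply, map_sub, map_mul]
  simp only [RingHom.mapMatrix_apply, annihilation_map_conj]

variable (L : ℕ) [NeZero L]

/-- `localPairOn S g L x` is a real matrix (real form factor). [folklore] -/
theorem localPairOn_map_conj (S : Finset (Site 2)) (g : Site 2 → ℝ) (x : TorusSite 2 L) :
    (localPairOn S g L x).map (starRingEnd ℂ) = localPairOn S g L x := by
  rw [localPairOn_eq_sum_bond, ← RingHom.mapMatrix_apply, map_sum]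
  refine Finset.sum_congr rfl fun e _ => ?_
  rw [RingHom.mapMatrix_apply, Matrix.map_smul' _ _ _ (map_mul (starRingEnd ℂ)), Complex.conj_ofReal,
    bond_map_conj]

/-- `P_g(x) = localPair g L x` is a real matrix. [folklore] -/
theorem localPair_map_conj (g : Site 2 → ℝ) (x : TorusSite 2 L) :
    (localPair g L x).map (starRingEnd ℂ) = localPair g L x :=
  localPairOn_map_conj L (insert 0 unitSteps) g x

end RealHubbard

end PairChirality

section TimeReversal

variable (L : ℕ) [NeZero L]

open PairChirality

/-- **Time-reversal oddness**: in the occupation basis all Jordan–Wigner matrices are real, so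
entrywise complex conjugation (time reversal for a real, `S^z`-conserving Hamiltonian) maps
`O_χ(x) = i(P₁ᴴP₂ - P₂ᴴP₁)` to `-O_χ(x)`. Fernandes–Orth–Schmalian (2019) §2.1 (`φ₂` breaks
time-reversal symmetry); Xiang–Wu (2022) §1.14. [folklore] -/
theorem pairChirality_map_conj (x : TorusSite 2 L) :
    (pairChirality L x).map (starRingEnd ℂ) = -pairChirality L x := by
  rw [pairChirality, Matrix.map_smul' _ _ _ (map_mul (starRingEnd ℂ)), Complex.conj_I, neg_smul]
  congr 2
  simp only [← RingHom.mapMatrix_apply, map_sub, map_mul]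
  simp only [RingHom.mapMatrix_apply, conjTranspose_map_conj, localPairOn_map_conj, localPair_map_conj]

/-- `X_L` is odd under entrywise complex conjugation. [folklore] -/
theorem totalPairChirality_map_conj :
    (totalPairChirality L).map (starRingEnd ℂ) = -totalPairChirality L := by
  rw [totalPairChirality, ← RingHom.mapMatrix_apply, map_sum, ← Finset.sum_neg_distrib]
  exact Finset.sum_congr rfl fun x _ => by rw [RingHom.mapMatrix_apply, pairChirality_map_conj]

/-- A Hermitian matrix that is odd under entrywise conjugation has vanishing expectation in every
real vector: `⟨ψ, A ψ⟩` is real (hermiticity) and equals minus its conjugate. [folklore] -/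
theorem PairChirality.expect_eq_zero_of_map_conj {ι : Type*} [Fintype ι]
    {A : Matrix (Finset ι) (Finset ι) ℂ} (hA : A.IsHermitian) (hA' : A.map (starRingEnd ℂ) = -A)
    {ψ : Fock ι} (hψ : star ψ = ψ) : expect A ψ = 0 := by
  have hreal : star (expect A ψ) = expect A ψ := by
    unfold expect
    conv_lhs => rw [star_dotProduct, star_star, star_mulVec, hA.eq, ← dotProduct_mulVec]
  have hodd : starRingEnd ℂ (expect A ψ) = -expect A ψ := by
    have hψ' : ∀ s, starRingEnd ℂ (ψ s) = ψ s := fun s => congrFun hψ s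
    have hA'' : ∀ s t, starRingEnd ℂ (A s t) = -A s t := fun s t => by
      simpa using congrFun (congrFun hA' s) t
    simp only [expect, dotProduct, mulVec, map_sum, map_mul, Pi.star_apply, hψ', hA'',
      Complex.star_def, neg_mul, mul_neg, Finset.sum_neg_distrib]
  rw [Complex.star_def] at hreal
  exact CharZero.eq_neg_self_iff.1 (hreal.symm.trans hodd)

/-- **No one-point signal in real states**: `⟨ψ, O_χ(x) ψ⟩ = 0` for every real Fock vector `ψ`
(e.g. any eigenvector chosen real of the real Hubbard Hamiltonian); chiral order is therefore
measured by the two-point functional `⟨Xᴴ X⟩`, never by `⟨X⟩`. Fernandes–Orth–Schmalian (2019)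
§2.1. [folklore] -/
theorem expect_pairChirality_eq_zero_of_star_eq (x : TorusSite 2 L)
    {ψ : Fock (Orb (FermionTorus 2 L))} (hψ : star ψ = ψ) : expect (pairChirality L x) ψ = 0 :=
  expect_eq_zero_of_map_conj (isHermitian_pairChirality L x) (pairChirality_map_conj L x) hψ

/-- `⟨ψ, X_L ψ⟩ = 0` for every real Fock vector `ψ`. [folklore] -/
theorem expect_totalPairChirality_eq_zero_of_star_eq
    {ψ : Fock (Orb (FermionTorus 2 L))} (hψ : star ψ = ψ) : expect (totalPairChirality L) ψ = 0 :=
  expect_eq_zero_of_map_conj (isHermitian_totalPairChirality L) (totalPairChirality_map_conj L) hψ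

end TimeReversal

end Literature.MathematicalPhysics.QuantumLattice
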